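import Summits.ABC.IUTFork.Cor312ThetaSideContentBoundK
import Summits.ABC.IUTFork.Cor312ThetaSideGaloisDescent
import Literature.IUT.LogVolume.GenuineLogThetaExactVolumeInput
import Literature.IUT.LogVolume.GenuineLogThetaPoint
import HarnessLib

/-!
# [IUTchIII] Corollary 3.12 — the Θ-side READ binder `hΘ` of the K-LEVEL branch-C certificates (line of record v6K / v7K)
# DISCHARGED: `−|log(Θ)|(settingPrVolSharp (pilotDataOfK D K) …) ≤ ↑(genuine −|log(Θ)| of D)` for EVERY realising choice of Θ-ideles

PROOF-ONLY file (D-0012; no definitions, no `Prop` facts) of the abc-iut cell (R2 S-chain team, seat abc-iut-s2-p6 gen 2, TARGET #2 `hΘ`;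
the assembly «hΘ-DESCENT @ v6K/v7K», inputs split BY NAME with abc-iut-s2-p7 gen 2). TAKES NO SIDE on [IUTchIII] Cor. 3.12.

THE BINDER. The S_H line of record of branch C («abc ⇐ S_H», `Conditional/AbcOfSGenuineKChosen.lean` `abc_of_SH_v6K` p437297, choice-free
twin `…KCanonical.lean` `abc_of_SH_v7K` p439097) carries, besides `hSH` (adjudication object) and the cone input `hreg`, ONE reading hypothesis:
`hΘ` — at every admissible datum `T` and every realising choice of pilot ideles, the typed `−|log(Θ)|` of abc-iut-c312-7's print-normalised
SHARP real setting over `K` (`settingPrVolSharp (pilotDataOfK T.D T.K)`, p422627: packets over ALL places of `K`, `Pr_K`-weights, sharp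
Dupuy–Hilado Θ-boxes `ι_j(t_{Θ,j,w})·(R_I)^∼`) is at most abc-iut-S2's GENUINE number `T.negLogTheta` (`GenuineLogTheta`: hull volumes over the
completions `K_{v̲}` at the SECTION `V̲ ≅ V_mod` of [IUTchI] Def. 3.1 (e), plus `((l+5)/4)·log π`). At the M-level setting this was closed by
abc-iut-s2-p8 (`Cor312ThetaSideClosedM`, p440655); at the K level the two sides are indexed by different place sets, and the missing step was
the Galois descent `𝕍(K)_p^{j+1} → V̲ ≅ 𝕍(F_mod)_p^{j+1}` ([IUTchI] Rmk. 3.1.5: «`K` is Galois over `F_mod`»; [IUTchIV] Thm. 1.10 Step (v) reads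
the packets over `V̲`). THIS FILE closes it:

* §1 `procAvg_sum_weightPr_content_below_eq_negLogThetaLoc` — per prime `p ∈ T(I)`: the `Pr_K`-weighted CONTENT-HULL sum of abc-iut-s2-p7's
  bound over all tuples `e` of places of `K` over `p`, for abc-iut-c312-3's EXACT content family `m_gen` of the genuine slot unions READ BELOW
  the tuples (`m_K(e) := m_gen(v⃗(e))`), averaged over the procession, EQUALS the genuine local term `negLogThetaLoc p` — abc-iut-w5-d056's
  descent `sum_weightPr_mul_contentHull_eq_placeSection` (p439911; `m_K` is `Gal(K/F_mod)`-invariant since conjugate places lie over the same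
  place, and takes the value `m_gen(v⃗)` at the section tuple `v̲⃗`) + abc-iut-c312-3's exact formula `negLogThetaLoc_eq_of_content` (the
  descended packets are abc-iut-S2's `K_{v̲}` on the nose);
* §2 **`negLogTheta_settingPrVolSharp_pilotDataOfK_le_genuine`** — for `D : InitialThetaData`, ANY genuine input `I` of `D` (`IsVolumeInputOf`),
  ANY q-ideles and EVERY realising Θ-ideles `t` (`ht0`, `hT`): `(settingPrVolSharp (pilotDataOfK D K) … tq t _ _).negLogTheta ≤ ↑I.negLogTheta`.
  Route: abc-iut-s2-p7 gen 2's `negLogTheta_settingPrVolSharp_pilotDataOfK_le_sum_content_below` (p446007 = gen 0's content-hull bound p438921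
  with the slot containment DISCHARGED by Galois transport from the section, `Cor312ThetaSideSlotTransportK` p445436) on the support `T(I)`
  (prime divisors of `2·disc K` and residue characteristics of `V^bad_mod`; [IUTchIV] Thm. 1.10 Step (vi)) with `A := ((l+5)/4)·log π`
  (Step (vii): the setting's archimedean term is `0`, whence `≤`, never `=`), then §1 prime by prime and Step (viii)'s bookkeeping;
* §3 `negLogTheta_settingPrVolSharp_pilotDataOfK_le_datum` — the same at a genuine Θ-volume DATUM `T : Cor22.ThetaVolumeDatumAt P l`, in the
  binder shape of `abc_of_SH_v7K`: its `hΘ` is this theorem applied pointwise (admissibility guards and the q-realising hypothesis unused);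
  v6K's chosen-ideles binder follows by abc-iut-C-cert-2's `GenuineK.chosen_iff_forall_realising`.

[cite: Mochizuki2012, IUTchIII Cor. 3.12 p. 173–174] [cite: Mochizuki2012, IUTchIV Thm. 1.10 Steps (v)–(viii) p. 27–30]
[cite: Mochizuki2012, IUTchI Def. 3.1 (e) p. 62; Rmk. 3.1.5 p. 65; Ex. 3.2 (iv) p. 71] [cite: DupuyHilado2025, §3.6, §3.9, Def. 3.6.3, §4.12]
[claim: Mochizuki2012, status: disputed] for every quoted construction. HONEST FRAMING: a comparison between OUR two typings of one printed
quantity (the setting's `−|log(Θ)|` at the sharp (Ind3) reading with DH-level (Ind1)/(Ind2) and trivial archimedean container, versus the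
datum's defined number); it removes a READING hypothesis from a CONDITIONAL certificate «abc ⇐ S_H + hreg» and asserts nothing about
[IUTchIII] Cor. 3.12, about `S_H`, or about abc; no side is taken on any author; typed ≠ proved; instantiated ≠ endorsed.
-/

noncomputable section

open Set Function NumberField IsDedekindDomain
open scoped Pointwise

namespace Summit.ABC.IUTFork.Thm311.Real

open Cor312 Cor312Vol Cor312Prov Literature.IUT.LogThetaLattice Literature.IUT.LogVolume Literature.IUT.HodgeTheaters
  Literature.NumberTheory.NumberFields

variable {F K Fbar : Type} [Field F] [NumberField F] [Field K] [NumberField K] [Algebra F K] [Field Fbar]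
  [Algebra F Fbar] [Algebra K Fbar] {E : WeierstrassCurve F} [E.IsElliptic] {l : ℕ} {Pb : BadPlacePredicates K}
  (D : InitialThetaData F K Fbar E l Pb) (r : ThetaData.IdeleData D)

/-! ## §1. Per prime: the descended content sum of the `K`-level sharp setting IS the genuine local term -/

/-- **Per prime `p`: the `Pr_K`-weighted content-hull sum over ALL tuples of places of `K` over `p`, for abc-iut-c312-3's EXACT content
family of the genuine input READ BELOW the tuples (`m_K(e) := m_gen(p, i, v⃗(e))`, `v⃗(e)` the places of `F_mod` under `e`), averaged over
the procession, IS abc-iut-S2's genuine local term `negLogThetaLoc p` of `volumeInputOf D r`** — abc-iut-w5-d056's Galois descent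
`𝕍(K)_p^{j+1} → V̲ ≅ 𝕍(F_mod)_p^{j+1}` (`sum_weightPr_mul_contentHull_eq_placeSection`, p439911; `m_K` is `Gal(K/F_mod)`-invariant because
conjugate places lie over the same place, `finBelow_smul`; at the section `v̲ ∩ 𝓞_{F_mod} = v`, `finBelow_lift`) followed by abc-iut-c312-3's
exact content formula `ThetaVolumeInput.negLogThetaLoc_eq_of_content` (the right-hand packets are abc-iut-S2's `K_{v̲}` ON THE NOSE).
[cite: Mochizuki2012, IUTchIV Thm. 1.10 proof Step (v) p. 28] [cite: Mochizuki2012, IUTchI Rmk. 3.1.5 p. 65]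
[cite: DupuyHilado2025, Def. 3.6.3, §4.12] -/
theorem procAvg_sum_weightPr_content_below_eq_negLogThetaLoc (pp : Nat.Primes) (hpT : (pp : ℕ) ∈ (ThetaData.volumeInputOf D r).supportPrimes)
    (mgen : (p : ℕ) → (i : Fin (ThetaData.volumeInputOf D r).lstar) → (Fin ((i : ℕ) + 1 + 1) → placesOver (fieldOfModuli E) p) → ℤ)
    (hmgen : ∀ (p : ℕ) [hp : Fact p.Prime], p ∈ (ThetaData.volumeInputOf D r).supportPrimes →
      ∀ (i : Fin (ThetaData.volumeInputOf D r).lstar) (e : Fin ((i : ℕ) + 1 + 1) → placesOver (fieldOfModuli E) p),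
      (⋃ a : Fin ((i : ℕ) + 1 + 1), iota p (fun b => ((ThetaData.volumeInputOf D r).σ.localFieldFamily p hp.out).k (e b)) a
            ((ThetaData.volumeInputOf D r).tΘ p hp.out i (e a) : ((ThetaData.volumeInputOf D r).σ.localFieldFamily p hp.out).k (e a)) •
          (normalizedPacket p (fun b => ((ThetaData.volumeInputOf D r).σ.localFieldFamily p hp.out).k (e b)) :
            Set (PacketAlgebra p (fun b => ((ThetaData.volumeInputOf D r).σ.localFieldFamily p hp.out).k (e b))))) ⊆
        ((p : ℚ_[p]) ^ mgen p i e) • (logPacket p (fun b => ((ThetaData.volumeInputOf D r).σ.localFieldFamily p hp.out).k (e b)) :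
            Set (PacketAlgebra p (fun b => ((ThetaData.volumeInputOf D r).σ.localFieldFamily p hp.out).k (e b)))) ∧
      ¬ (⋃ a : Fin ((i : ℕ) + 1 + 1), iota p (fun b => ((ThetaData.volumeInputOf D r).σ.localFieldFamily p hp.out).k (e b)) a
            ((ThetaData.volumeInputOf D r).tΘ p hp.out i (e a) : ((ThetaData.volumeInputOf D r).σ.localFieldFamily p hp.out).k (e a)) •
          (normalizedPacket p (fun b => ((ThetaData.volumeInputOf D r).σ.localFieldFamily p hp.out).k (e b)) :
            Set (PacketAlgebra p (fun b => ((ThetaData.volumeInputOf D r).σ.localFieldFamily p hp.out).k (e b))))) ⊆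
        ((p : ℚ_[p]) ^ (mgen p i e + 1)) • (logPacket p (fun b => ((ThetaData.volumeInputOf D r).σ.localFieldFamily p hp.out).k (e b)) :
            Set (PacketAlgebra p (fun b => ((ThetaData.volumeInputOf D r).σ.localFieldFamily p hp.out).k (e b))))) :
    haveI : Fact (pp : ℕ).Prime := ⟨pp.2⟩
    (1 / ((thetaIndex (pilotDataOfK D K)).lstar : ℝ)) * ∑ i : Fin (thetaIndex (pilotDataOfK D K)).lstar,
        ∑ e : (presAt (pilotDataOfK D K) (logvAnalytic_analyticLogv (F := K)) pp).toLocalPieces.E (Setting.labelSucc i),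
          weightPr (pilotDataOfK D K) pp.1 (Setting.labelSucc i) e *
            (-(mgen pp.1 i (fun b =>
                ⟨Literature.IUT.LogVolume.finBelow (fieldOfModuli E) K (placeOf (pilotDataOfK D K) pp.1 (e b)),
                  finBelow_mem_placesOver (fieldOfModuli E) K (placeOf_mem (pilotDataOfK D K) pp.1 (e b))⟩) * Real.log pp) +
              packetLogμ pp.1 ((presAt (pilotDataOfK D K) (logvAnalytic_analyticLogv (F := K)) pp).kk e)
                (packetHull pp.1 ((presAt (pilotDataOfK D K) (logvAnalytic_analyticLogv (F := K)) pp).kk e)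
                  (logPacket pp.1 ((presAt (pilotDataOfK D K) (logvAnalytic_analyticLogv (F := K)) pp).kk e) :
                    Set ((presAt (pilotDataOfK D K) (logvAnalytic_analyticLogv (F := K)) pp).X e)))) =
      (ThetaData.volumeInputOf D r).negLogThetaLoc pp.1 := by
  haveI : Fact (pp : ℕ).Prime := ⟨pp.2⟩
  haveI := D.isGalois_fieldOfModuli_K
  rw [(ThetaData.volumeInputOf D r).negLogThetaLoc_eq_of_content pp.1 (mgen pp.1) (hmgen pp.1 hpT)]
  -- both sides are procession averages over `Fin ℓ⋆` (the same type)
  refine congrArg ((1 / ((thetaIndex (pilotDataOfK D K)).lstar : ℝ)) * ·) (Fintype.sum_congr _ _ fun i => ?_)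
  -- descend the `K`-level sum to the section (abc-iut-w5-d056), for the label `j = i+1`; the summand index carries the
  -- `Fintype` instance of abc-iut-c312-5's local pieces (`Fintype.ofFinite`)
  letI : Fintype ((thetaIndex (pilotDataOfK D K)).Caps (Setting.labelSucc i) →
      (thetaIndex (pilotDataOfK D K)).Fibre (.inr (ratPrime pp.1))) :=
    (presAt (pilotDataOfK D K) (logvAnalytic_analyticLogv (F := K)) pp).toLocalPieces.instFintype (Setting.labelSucc i)
  have hdesc := sum_weightPr_mul_contentHull_eq_placeSection (F₀ := fieldOfModuli E) (pilotDataOfK D K) pp.1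
    (Setting.labelSucc i) (ThetaData.placeSection D)
    (fun w => mgen pp.1 i (fun a => ⟨Literature.IUT.LogVolume.finBelow (fieldOfModuli E) K (w a).1,
      finBelow_mem_placesOver (fieldOfModuli E) K (w a).2⟩))
    (fun g w => by
      congr 1
      funext a
      exact Subtype.ext (finBelow_smul (fieldOfModuli E) K (g a) (w a).1))
  refine hdesc.trans (Finset.sum_congr rfl fun v _ => ?_)
  have hv : mgen pp.1 i (fun a => ⟨Literature.IUT.LogVolume.finBelow (fieldOfModuli E) K ((ThetaData.placeSection D).lift (v a).1),
      finBelow_mem_placesOver (fieldOfModuli E) K ((ThetaData.placeSection D).lift_mem_placesOver (v a))⟩) = mgen pp.1 i v :=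
    congrArg (mgen pp.1 i) (funext fun a => Subtype.ext (finBelow_lift (fieldOfModuli E) K (ThetaData.placeSection D) (v a).1))
  dsimp only
  rw [hv, mul_comm]
  rfl

/-! ## §2. The READ binder `hΘ` of the K-level certificates DISCHARGED -/

section Closed

variable (M : Type) [Field M] [NumberField M]
  (archPk : ∀ (j : (thetaIndex (pilotDataOfK D K)).Label) (vQ : (thetaIndex (pilotDataOfK D K)).VQ),
    Set ((logShellsDH (pilotDataOfK D K) (analyticLogv K)).Packet j vQ))
  (archSub : ∀ (j : (thetaIndex (pilotDataOfK D K)).Label) (v : (thetaIndex (pilotDataOfK D K)).V),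
    Set ((logShellsDH (pilotDataOfK D K) (analyticLogv K)).Packet j ((thetaIndex (pilotDataOfK D K)).over v)))
  (Ψ : ℤ → ∀ v : (thetaIndex (pilotDataOfK D K)).V, v ∈ (thetaIndex (pilotDataOfK D K)).Vbad →
    Set ((logShellsDH (pilotDataOfK D K) (analyticLogv K)).StarPacket v))
  (act : ℤ → ∀ v : (thetaIndex (pilotDataOfK D K)).V, v ∈ (thetaIndex (pilotDataOfK D K)).Vbad →
    (logShellsDH (pilotDataOfK D K) (analyticLogv K)).StarPacket v →
      Module.End ℚ ((logShellsDH (pilotDataOfK D K) (analyticLogv K)).StarPacket v))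
  (Mmod : ℤ → ∀ j : (thetaIndex (pilotDataOfK D K)).LabelStar,
    Set ((logShellsDH (pilotDataOfK D K) (analyticLogv K)).GlobalPacket j.1))
  (region : ℤ → ∀ j : (thetaIndex (pilotDataOfK D K)).LabelStar, FinDivisor M → ∀ vQ : (thetaIndex (pilotDataOfK D K)).VQ,
    Set ((logShellsDH (pilotDataOfK D K) (analyticLogv K)).Packet j.1 vQ))
  (n : ℤ) {HT : Type} {LogLink : HT → HT → Type} {IsFull : ∀ {s t : HT}, LogLink s t → Prop}
  (lat : LGPGaussianLogThetaLattice LogLink IsFull)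
  {Frd : Type} {IsoF : Frd → Frd → Type} {Ob : Frd → Type} {realify : Frd → Frd} {Strip : Type}
  {IsoS : Strip → Strip → Type}
  {Mv : ∀ v : (thetaIndex (pilotDataOfK D K)).V, v ∈ (thetaIndex (pilotDataOfK D K)).Vbad → Type} [∀ v h, Monoid (Mv v h)]
  (sig : GlobalLGPFrobenioidSignature (thetaIndex (pilotDataOfK D K)).lstar (thetaIndex (pilotDataOfK D K)).V
    (· ∈ (thetaIndex (pilotDataOfK D K)).Vbad) Frd IsoF Ob realify Strip IsoS Mv)
  (split : SplittingMonoids Mv) {ObΔ : Type}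
  {N : ∀ v : (thetaIndex (pilotDataOfK D K)).V, v ∈ (thetaIndex (pilotDataOfK D K)).Vbad → Type} [∀ v h, Monoid (N v h)]
  (qData : QPilotData ObΔ N)
  (tq : ∀ (pp : Nat.Primes) (x : (thetaIndex (pilotDataOfK D K)).Fibre (.inr pp)),
    haveI : Fact (pp : ℕ).Prime := ⟨pp.2⟩; kOf (pilotDataOfK D K) pp.1 x)
  (t : ∀ (pp : Nat.Primes) (_ : Fin (pilotDataOfK D K).lstar) (x : (thetaIndex (pilotDataOfK D K)).Fibre (.inr pp)),
    haveI : Fact (pp : ℕ).Prime := ⟨pp.2⟩; kOf (pilotDataOfK D K) pp.1 x)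
  (htq0 : ∀ pp x, tq pp x ≠ 0)
  (htq1 : ∀ (pp : Nat.Primes) (x : (thetaIndex (pilotDataOfK D K)).Fibre (.inr pp)),
    haveI : Fact (pp : ℕ).Prime := ⟨pp.2⟩; placeOf (pilotDataOfK D K) pp.1 x ∉ (pilotDataOfK D K).S → ‖tq pp x‖ = 1)

omit r in
/-- **`hΘ` DISCHARGED ON THE K-LEVEL LINE (branch C, v6K / v7K).** At abc-iut-c312-7's print-normalised SHARP real setting over `K` of the
pilot datum OF `D` (`settingPrVolSharp (pilotDataOfK D K)`, analytic logarithms), read off ANY q-ideles `tq` and ANY Θ-ideles `t` REALISING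
`P_Θ` in Dupuy–Hilado's normalisation (`ht0`, `hT` — exactly the binders of v7K's `hΘ`; [IUTchI] Ex. 3.2 (iv): `q̲_v` is ANY `2l`-th root),
the typed `−|log(Θ)|` is at most abc-iut-S2's genuine `−|log(Θ)|` of ANY genuine Θ-volume input OF `D`:
`(settingPrVolSharp (pilotDataOfK D K) … tq t _ _).negLogTheta ≤ ↑I.negLogTheta`.
Proof (no cross-field step, no side): `I = volumeInputOf D r` (abc-iut-S2 `exists_eq_volumeInputOf`); abc-iut-c312-3's exact content
family `m_gen` of its slot unions (`exists_contentFamily`); abc-iut-s2-p7's content-hull bound with `hslot` DISCHARGED for the family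
`m_K(e) := m_gen(v⃗(e))` (`negLogTheta_settingPrVolSharp_pilotDataOfK_le_sum_content_below`, p446007, on `Tp := T(I)` — the prime divisors of
`2·disc K` and the residue characteristics of `V^bad_mod`, [IUTchIV] Thm. 1.10 Step (vi)) with `A := ((l+5)/4)·log π ≥ 0` (Step (vii); the
setting's archimedean term is `0`, whence `≤`); §1 identifies each prime's term with `negLogThetaLoc p` ([IUTchI] Rmk. 3.1.5 descent), and
`Σ_{p∈T(I)} negLogThetaLoc p + ((l+5)/4)·log π = negLogTheta I` by definition (Step (viii)). [cite: Mochizuki2012, IUTchIII Cor. 3.12 p. 173–174]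
[cite: Mochizuki2012, IUTchIV Thm. 1.10 Steps (v)–(viii) p. 27–30] [cite: Mochizuki2012, IUTchI Rmk. 3.1.5 p. 65; Ex. 3.2 (iv) p. 71]
[cite: DupuyHilado2025, §3.9, Def. 3.6.3, §4.12] -/
theorem negLogTheta_settingPrVolSharp_pilotDataOfK_le_genuine (ht0 : ∀ pp i x, t pp i x ≠ 0)
    (hT : ∀ (pp : Nat.Primes) (i : Fin (pilotDataOfK D K).lstar) (x : (thetaIndex (pilotDataOfK D K)).Fibre (.inr pp)),
      haveI : Fact (pp : ℕ).Prime := ⟨pp.2⟩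
      Real.log ‖t pp i x‖ = -((pilotDataOfK D K).thetaPilot i (placeOf (pilotDataOfK D K) pp.1 x)) *
        logNorm K (placeOf (pilotDataOfK D K) pp.1 x) / localDegree K (placeOf (pilotDataOfK D K) pp.1 x))
    {I : ThetaVolumeInput (fieldOfModuli E) K} (hI : ThetaData.IsVolumeInputOf D I) :
    (settingPrVolSharp (pilotDataOfK D K) (logvAnalytic_analyticLogv (F := K)) M archPk archSub Ψ act Mmod region n lat
        sig split qData tq t htq0 htq1).negLogTheta ≤ ((I.negLogTheta : ℝ) : WithTop ℝ) := by
  obtain ⟨r, rfl⟩ := ThetaData.exists_eq_volumeInputOf D hI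
  -- abc-iut-c312-3's exact content family of the genuine slot unions
  obtain ⟨mgen, hmgen⟩ := (ThetaData.volumeInputOf D r).exists_contentFamily
  -- the support `T(I)` as a finite set of primes, and abc-iut-s2-p7's closure condition for it
  have hTp : ∀ pp ∈ ((ThetaData.volumeInputOf D r).supportPrimes.subtype Nat.Prime : Finset Nat.Primes),
      (pp : ℕ) ∈ (ThetaData.volumeInputOf D r).supportPrimes := fun pp hpp => Finset.mem_subtype.mp hpp
  have hTp' : ∀ pp : Nat.Primes,
      ((pp : ℕ) ∣ 2 * (NumberField.discr K).natAbs ∨ ∃ v ∈ (pilotDataOfK D K).S, ((pp : ℕ) : 𝓞 K) ∈ v.asIdeal) →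
        pp ∈ ((ThetaData.volumeInputOf D r).supportPrimes.subtype Nat.Prime : Finset Nat.Primes) := by
    intro pp hpp
    refine Finset.mem_subtype.mpr ?_
    rcases hpp with h | ⟨v, hv, hpv⟩
    · refine Finset.mem_union_left _ (Nat.mem_primeFactors.mpr ⟨pp.2, h, ?_⟩)
      exact mul_ne_zero two_ne_zero (Int.natAbs_ne_zero.mpr (NumberField.discr_ne_zero K))
    · haveI : Fact (pp : ℕ).Prime := ⟨pp.2⟩
      have hchar : residueChar (fieldOfModuli E) (Literature.IUT.LogVolume.finBelow (fieldOfModuli E) K v) = pp :=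
        (residueChar_finBelow (F := fieldOfModuli E) v).trans (residueChar_eq_of_natCast_mem (F := K) pp.1 hpv)
      have hmem := (ThetaData.volumeInputOf D r).residueChar_mem_supportPrimes
        ((mem_S_pilotDataOfK_iff_finBelow_mem D v).mp hv)
      rw [hchar] at hmem
      exact hmem
  -- abc-iut-s2-p7's content-hull bound with `hslot` DISCHARGED (p446007), `A := ((l+5)/4)·log π`
  have key := negLogTheta_settingPrVolSharp_pilotDataOfK_le_sum_content_below D r mgen hmgen t
    (logvAnalytic_analyticLogv (F := K)) M archPk archSub Ψ act Mmod region n lat sig split qData tq ht0 hT htq0 htq1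
    ((ThetaData.volumeInputOf D r).supportPrimes.subtype Nat.Prime : Finset Nat.Primes) hTp hTp'
    (ThetaVolumeInput.archLogTheta_pos l).le
  refine key.trans (le_of_eq ?_)
  congr 1
  -- the global bookkeeping: `Σ_{p∈T(I)} negLogThetaLoc p + ((l+5)/4)·log π = negLogTheta`
  show _ = (ThetaData.volumeInputOf D r).negLogThetaNonarch + ThetaVolumeInput.archLogTheta l
  congr 1
  rw [ThetaVolumeInput.negLogThetaNonarch, ← Finset.sum_subtype_of_mem (fun p => (ThetaData.volumeInputOf D r).negLogThetaLoc p)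
    (fun p hp => (ThetaData.volumeInputOf D r).prime_of_mem_supportPrimes hp)]
  refine Finset.sum_congr rfl fun pp hpp => ?_
  exact procAvg_sum_weightPr_content_below_eq_negLogThetaLoc D r pp (hTp pp hpp) mgen hmgen

end Closed


/-! ## §3. At a genuine Θ-volume DATUM (the binder shape of the certificates `abc_of_SH_v6K` / `abc_of_SH_v7K`) -/

/-- **`hΘ` of `abc_of_SH_v7K` (p439097) / `abc_of_SH_v6K` (p437297), PER DATUM, AS A THEOREM**: for every genuine Θ-volume datum `T` at a
point `P` and prime `l` (abc-iut-S2's `Cor22.ThetaVolumeDatumAt`), every context of abc-iut-c312-7's sharp real setting over `T.K` at the pilot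
datum `pilotDataOfK T.D T.K`, every q-idele `tq` (non-zero, units off `S`) and EVERY realising Θ-idele `t` (`ht0`, `hT`):
`(settingPrVolSharp (pilotDataOfK T.D T.K) … tq t _ _).negLogTheta ≤ ↑T.negLogTheta` — so v7K's `hΘ` is
`fun P _ l _ _ _ _ _ _ T tq t htq0 htq1 ht0 hT _ => negLogTheta_settingPrVolSharp_pilotDataOfK_le_datum T … tq t htq0 htq1 ht0 hT`
(the admissibility guards and the q-realising hypothesis are not used), and v6K's follows by `GenuineK.chosen_iff_forall_realising`.
HONEST SCOPE: a comparison of OUR two typings of `−|log(Θ)|` at the datum; nothing about [IUTchIII] Cor. 3.12 itself.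
[cite: Mochizuki2012, IUTchIII Cor. 3.12 p. 173–174] [cite: Mochizuki2012, IUTchIV Thm. 1.10 Steps (v)–(viii) p. 27–30] -/
theorem negLogTheta_settingPrVolSharp_pilotDataOfK_le_datum
    {P : Literature.NumberTheory.DiophantineGeometry.GenEll.NFPoint} {l : ℕ} (T : Cor22.ThetaVolumeDatumAt P l) :
    letI := T.instFieldF; letI := T.instNumberFieldF; letI := T.instAlgebraF; letI := T.instFieldK;
    letI := T.instNumberFieldK; letI := T.instAlgebraK; letI := T.instFieldFbar; letI := T.instAlgebraFbar;
    letI := T.instAlgebraKFbar; letI := T.instIsElliptic;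
    ∀ (M : Type) [Field M] [NumberField M]
      (archPk : ∀ (j : (thetaIndex (pilotDataOfK T.D T.K)).Label) (vQ : (thetaIndex (pilotDataOfK T.D T.K)).VQ),
        Set ((logShellsDH (pilotDataOfK T.D T.K) (analyticLogv T.K)).Packet j vQ))
      (archSub : ∀ (j : (thetaIndex (pilotDataOfK T.D T.K)).Label) (v : (thetaIndex (pilotDataOfK T.D T.K)).V),
        Set ((logShellsDH (pilotDataOfK T.D T.K) (analyticLogv T.K)).Packet j ((thetaIndex (pilotDataOfK T.D T.K)).over v)))
      (Ψ : ℤ → ∀ v : (thetaIndex (pilotDataOfK T.D T.K)).V, v ∈ (thetaIndex (pilotDataOfK T.D T.K)).Vbad →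
        Set ((logShellsDH (pilotDataOfK T.D T.K) (analyticLogv T.K)).StarPacket v))
      (act : ℤ → ∀ v : (thetaIndex (pilotDataOfK T.D T.K)).V, v ∈ (thetaIndex (pilotDataOfK T.D T.K)).Vbad →
        (logShellsDH (pilotDataOfK T.D T.K) (analyticLogv T.K)).StarPacket v →
          Module.End ℚ ((logShellsDH (pilotDataOfK T.D T.K) (analyticLogv T.K)).StarPacket v))
      (Mmod : ℤ → ∀ j : (thetaIndex (pilotDataOfK T.D T.K)).LabelStar,
        Set ((logShellsDH (pilotDataOfK T.D T.K) (analyticLogv T.K)).GlobalPacket j.1))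
      (region : ℤ → ∀ j : (thetaIndex (pilotDataOfK T.D T.K)).LabelStar, FinDivisor M →
        ∀ vQ : (thetaIndex (pilotDataOfK T.D T.K)).VQ, Set ((logShellsDH (pilotDataOfK T.D T.K) (analyticLogv T.K)).Packet j.1 vQ))
      (n : ℤ) {HT : Type} {LogLink : HT → HT → Type} {IsFull : ∀ {s t : HT}, LogLink s t → Prop}
      (lat : LGPGaussianLogThetaLattice LogLink IsFull)
      {Frd : Type} {IsoF : Frd → Frd → Type} {Ob : Frd → Type} {realify : Frd → Frd} {Strip : Type}
      {IsoS : Strip → Strip → Type}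
      {Mv : ∀ v : (thetaIndex (pilotDataOfK T.D T.K)).V, v ∈ (thetaIndex (pilotDataOfK T.D T.K)).Vbad → Type}
      [∀ v h, Monoid (Mv v h)]
      (sig : GlobalLGPFrobenioidSignature (thetaIndex (pilotDataOfK T.D T.K)).lstar (thetaIndex (pilotDataOfK T.D T.K)).V
        (· ∈ (thetaIndex (pilotDataOfK T.D T.K)).Vbad) Frd IsoF Ob realify Strip IsoS Mv)
      (split : SplittingMonoids Mv) {ObΔ : Type}
      {N : ∀ v : (thetaIndex (pilotDataOfK T.D T.K)).V, v ∈ (thetaIndex (pilotDataOfK T.D T.K)).Vbad → Type} [∀ v h, Monoid (N v h)]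
      (qData : QPilotData ObΔ N)
      (tq : ∀ (pp : Nat.Primes) (x : (thetaIndex (pilotDataOfK T.D T.K)).Fibre (.inr pp)),
        haveI : Fact (pp : ℕ).Prime := ⟨pp.2⟩; kOf (pilotDataOfK T.D T.K) pp.1 x)
      (t : ∀ (pp : Nat.Primes) (_ : Fin (pilotDataOfK T.D T.K).lstar) (x : (thetaIndex (pilotDataOfK T.D T.K)).Fibre (.inr pp)),
        haveI : Fact (pp : ℕ).Prime := ⟨pp.2⟩; kOf (pilotDataOfK T.D T.K) pp.1 x)
      (htq0 : ∀ pp x, tq pp x ≠ 0)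
      (htq1 : ∀ (pp : Nat.Primes) (x : (thetaIndex (pilotDataOfK T.D T.K)).Fibre (.inr pp)),
        haveI : Fact (pp : ℕ).Prime := ⟨pp.2⟩; placeOf (pilotDataOfK T.D T.K) pp.1 x ∉ (pilotDataOfK T.D T.K).S → ‖tq pp x‖ = 1),
      (∀ pp i x, t pp i x ≠ 0) →
      (∀ (pp : Nat.Primes) (i : Fin (pilotDataOfK T.D T.K).lstar) (x : (thetaIndex (pilotDataOfK T.D T.K)).Fibre (.inr pp)),
        haveI : Fact (pp : ℕ).Prime := ⟨pp.2⟩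
        Real.log ‖t pp i x‖ = -((pilotDataOfK T.D T.K).thetaPilot i (placeOf (pilotDataOfK T.D T.K) pp.1 x)) *
          logNorm T.K (placeOf (pilotDataOfK T.D T.K) pp.1 x) / localDegree T.K (placeOf (pilotDataOfK T.D T.K) pp.1 x)) →
      (settingPrVolSharp (pilotDataOfK T.D T.K) (logvAnalytic_analyticLogv (F := T.K)) M archPk archSub Ψ act Mmod region n lat
          sig split qData tq t htq0 htq1).negLogTheta ≤ ((T.negLogTheta : ℝ) : WithTop ℝ) := by
  intro M _ _ archPk archSub Ψ act Mmod region n HT LogLink IsFull lat Frd IsoF Ob realify Strip IsoS Mv _ sig split ObΔ N _ qData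
    tq t htq0 htq1 ht0 hT
  letI := T.instFieldF; letI := T.instNumberFieldF; letI := T.instAlgebraF; letI := T.instFieldK
  letI := T.instNumberFieldK; letI := T.instAlgebraK; letI := T.instFieldFbar; letI := T.instAlgebraFbar
  letI := T.instAlgebraKFbar; letI := T.instIsElliptic
  exact negLogTheta_settingPrVolSharp_pilotDataOfK_le_genuine T.D M archPk archSub Ψ act Mmod region n lat sig split qData tq t htq0
    htq1 ht0 hT T.isVolumeInputOf

end Summit.ABC.IUTFork.Thm311.Real
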